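import Mathlib
import HarnessLib
import Literature.AlgebraicGeometry.Ramification.InertiaNormalSylow
import Summits.ResolutionOfSingularities.ResolutionOfSingularities.Theorems.WildQuotientsWildQuotientResolutionTameOrbitMove
import Summits.ResolutionOfSingularities.ResolutionOfSingularities.Theorems.WildQuotientsWildQuotientResolutionTameCoresPhaseZero

/-!
# Phase 0 in EVERY dimension for a SEPARATED tame family: one ORBIT tame move
# (crux `WildQuotients.WildQuotientResolution`, stub `stub_phaseZeroHighDim`)

Crux stmt-ResolutionOfSingularities-15640 (`WildQuotientResolution`), registered stub `stub_phaseZeroHighDim`.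
The slices ✓`phaseZero_of_tameCore(s)` (p822102/p822635) need the cores to be NORMAL, so that their inert loci are
`G`-stable centres. The first step beyond normal cores uses the ORBIT tame move (✓`tameOrbitMove`, p820631): a
conjugation-stable finite family `S` of tame subgroups whose inert loci are PAIRWISE DISJOINT is blown up at once
(centre `W = ⋃_{K ∈ S} Z_K`, regular, `G`-stable, ✓`tameOrbitCentre` p820560).

**Theorem** (`phaseZero_of_separatedTameFamily`). Let `S` be a finite conjugation-stable family of non-trivial
subgroups of `G` of order prime to `p` whose inert loci on `X′` are pairwise disjoint, such that every element
`h ≠ 1` of order prime to `p` of every subgroup without a normal Sylow `p`-subgroup has `K ≤ ⟨h⟩` for some `K ∈ S`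
(e.g. `S` = the conjugacy class of a tame cyclic core whose conjugates have disjoint fixed loci). Then the
conclusion of `stub_phaseZeroHighDim` holds for the crux datum, in every dimension: ONE orbit move along `W`.
This isolates exactly what the general stub still needs — ORBIT SEPARATION: making the inert loci of the conjugates
disjoint by preliminary blow-ups (evidence memo PHASE0-STANDARD-FORM.md §5).

[OURS · crux stmt-ResolutionOfSingularities-15640 · helper toward `stub_phaseZeroHighDim` (an all-dimensional SLICE
of the stub for separated tame families; NOT a proof of the stub); counted 0; AI-level work, weaker than expert
review.] [folklore]
-/

-- single-problem summit: the doubled namespace component `ResolutionOfSingularities` is forced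
set_option linter.dupNamespace false

noncomputable section

open CategoryTheory AlgebraicGeometry TopologicalSpace IsLocalRing
open Literature.AlgebraicGeometry.Resolution Literature.AlgebraicGeometry.Ramification
open Scheme.IdealSheafData
open Summit.ResolutionOfSingularities.ResolutionOfSingularities.Theorems.WildQuotientResolution.PointBlowupStalkData
open Summit.ResolutionOfSingularities.ResolutionOfSingularities.Theorems.WildQuotientResolution.InertLocusStalk

namespace Summit.ResolutionOfSingularities.ResolutionOfSingularities.Theorems.WildQuotientResolution.StandardForm

/-- **Phase 0 in every dimension for a separated tame family** (crux stmt-ResolutionOfSingularities-15640, a SLICE of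
`stub_phaseZeroHighDim`). See the module docstring. [folklore] -/
theorem phaseZero_of_separatedTameFamily (p : ℕ) (hp : p.Prime) (k : Type) [Field k] [CharP k p]
    (X' X₁ : Scheme.{0}) (f : X₁ ⟶ Spec (.of k)) (q : X' ⟶ X₁) (G : Type) [Group G] [Finite G]
    (ρ : G →* Aut X') (hfaith : Function.Injective ρ)
    [IsSeparated f] [LocallyOfFiniteType f] [QuasiCompact f] [IsIntegral X']
    (hreg : Scheme.IsRegular X') [IsFinite q] (hρ : ∀ g : G, (ρ g).hom ≫ q = q)
    (S : Finset (Subgroup G)) (hS : ∀ (g : G), ∀ K ∈ S, K.map (MulAut.conj g).toMonoidHom ∈ S)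
    (hS1 : ⊥ ∉ S) (hcop : ∀ K ∈ S, (Nat.card K).Coprime p)
    (hdisj : ∀ K ∈ S, ∀ K' ∈ S, K ≠ K' →
      Disjoint {y : X' | K ≤ inertiaSubgroup ρ y} {y : X' | K' ≤ inertiaSubgroup ρ y})
    (hcore : ∀ H : Subgroup G, ¬ HasNormalSylow p H →
      ∀ h ∈ H, h ≠ 1 → (orderOf h).Coprime p → ∃ K ∈ S, K ≤ Subgroup.zpowers h) :
    ∃ (Xs : Scheme.{0}) (π : Xs ⟶ X') (ρs : G →* Aut Xs), IsProper π ∧ IsBirational π ∧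
      IsIntegral Xs ∧ Scheme.IsRegular Xs ∧ (∀ g : G, (ρs g).hom ≫ π = π ≫ (ρ g).hom) ∧
      (∀ x : Xs, HasNormalSylow p (inertiaSubgroup ρs x)) ∧
      ∀ x : Xs, ∃ U : Xs.Opens, IsAffineOpen U ∧ x ∈ U ∧ ∀ g : G, (ρs g).hom ⁻¹ᵁ U = U := by
  classical
  haveI : Fact p.Prime := ⟨hp⟩
  haveI : IsLocallyNoetherian X' := LocallyOfFiniteType.isLocallyNoetherian (q ≫ f)
  have hcharX : ∀ z : X', CharP (ResidueField (X'.presheaf.stalk z)) p := fun z =>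
    (((IsLocalRing.residue (X'.presheaf.stalk z)).comp ((X'.presheaf.germ ⊤ z trivial).hom.comp
      (((q ≫ f).appTop).hom.comp (Scheme.ΓSpecIso (.of k)).inv.hom))).charP_iff_charP p).mp inferInstance
  have hZ : ∀ K : Subgroup G, IsClosed {y : X' | K ≤ inertiaSubgroup ρ y} := fun K =>
    PointMoveNoNpcCurves.isClosed_setOf_le_inertia q ρ hρ K
  -- the orbit centre `W`
  have hregK : ∀ K ∈ S, Scheme.IsRegular
      (vanishingIdeal ⟨{y : X' | K ≤ inertiaSubgroup ρ y}, hZ K⟩).subscheme := fun K hK =>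
    isRegular_subscheme_vanishingIdeal_inertLocus_of_coprime ρ K p (hZ K) (fun x _ => hreg x)
      (fun x _ => hcharX x) (hcop K hK)
  obtain ⟨hW, h𝒥inv, hregW, -⟩ := tameOrbitCentre ρ S hS hZ hdisj hregK
  set Wc : Closeds X' := ⟨⋃ K ∈ S, {y : X' | K ≤ inertiaSubgroup ρ y}, hW⟩ with hWcdef
  set 𝒥 : X'.IdealSheafData := vanishingIdeal Wc with h𝒥def
  -- THE ORBIT MOVE
  obtain ⟨_, Xs, π, ρs, hπp, hbir, hXs, hXsreg, hequiv, hπ, hle, hcov⟩ :=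
    tameOrbitMove p hp k X' X₁ f q G ρ hfaith hreg hρ S hS hS1 hcop hdisj
  haveI := hπp; haveI := hXs
  haveI : IsLocallyNoetherian Xs := LocallyOfFiniteType.isLocallyNoetherian (π ≫ q ≫ f)
  -- the exceptional divisor: snc, invariant, stable support
  have hsnc : HasSNC (([] : List X'.IdealSheafData).map (strictTransformIdeal π 𝒥) ++ [𝒥.comap π]) :=
    (hasSNCWith_nil_of_isRegular hreg hregW).hasSNC_transform hπ
  set D : Xs.IdealSheafData := 𝒥.comap π with hDdef
  have hDmem : D ∈ ([] : List X'.IdealSheafData).map (strictTransformIdeal π 𝒥) ++ [𝒥.comap π] := by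
    simp [hDdef]
  have hDinv : ∀ g : G, D.comap (ρs g).hom = D := fun g =>
    comap_comap_of_invariant ρs ρ π hequiv h𝒥inv g
  have hDstab : ∀ g : G, (ρs g).hom.base ⁻¹' (D.support : Set Xs) = D.support := fun g =>
    preimage_support_of_comap_eq ρs g (hDinv g)
  have hDsupp : (D.support : Set Xs) = π.base ⁻¹' (Wc : Set X') := by
    rw [hDdef, support_comap]
    change π.base ⁻¹' ((𝒥.support : Closeds X') : Set X') = _
    rw [h𝒥def, Scheme.IdealSheafData.coe_support_vanishingIdeal]
  have hρs : ∀ g : G, (ρs g).hom ≫ (π ≫ q ≫ f) = π ≫ q ≫ f := fun g => by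
    rw [← Category.assoc, hequiv g, Category.assoc, ← Category.assoc (ρ g).hom, hρ g]
  have hcharS : ∀ x : Xs, CharP (ResidueField (Xs.presheaf.stalk x)) p := fun x =>
    (((IsLocalRing.residue (Xs.presheaf.stalk x)).comp ((Xs.presheaf.germ ⊤ x trivial).hom.comp
      (((π ≫ q ≫ f).appTop).hom.comp (Scheme.ΓSpecIso (.of k)).inv.hom))).charP_iff_charP p).mp
      inferInstance
  have hZ' : ∀ K : Subgroup G, IsClosed {x' : Xs | K ≤ inertiaSubgroup ρs x'} := fun K =>
    PointMoveNoNpcCurves.isClosed_setOf_le_inertia (π ≫ q ≫ f) ρs hρs K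
  -- a member of `S` contained in `⟨g⟩` puts `Z_⟨g⟩` inside `W`
  have hZW : ∀ (g : G), ∀ K ∈ S, K ≤ Subgroup.zpowers g →
      {y : X' | Subgroup.zpowers g ≤ inertiaSubgroup ρ y} ⊆ (Wc : Set X') := by
    intro g K hK hKg y hy
    exact Set.mem_biUnion hK (le_trans hKg hy)
  refine ⟨Xs, π, ρs, hπp, hbir, hXs, hXsreg, hequiv, fun x => ?_, hcov⟩
  haveI := hcharS x
  haveI := hXsreg x
  by_contra hnpc
  have htame := hcore (inertiaSubgroup ρs x) hnpc
  -- `x` lies on the exceptional divisor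
  obtain ⟨h, hhI, hh1, hhcop⟩ := exists_ne_one_coprime_of_not_hasNormalSylow (inertiaSubgroup ρs x) hnpc
  obtain ⟨K, hK, hKh⟩ := htame h hhI hh1 hhcop
  have hπx : π.base x ∈ (Wc : Set X') :=
    hZW h K hK hKh (le_trans ((Subgroup.zpowers_le).mpr hhI) (hle x))
  have hxD : x ∈ D.support := by
    change x ∈ (D.support : Set Xs)
    rw [hDsupp]
    exact hπx
  -- the local equation `t` of the exceptional divisor at `x`
  obtain ⟨hregx, u, hu, ⟨ι, -, hι⟩, -⟩ := hsnc x
  have hrsop : IsRsopPart (u ∘ id) := isRsopPart_comp_of_rsop rfl u hu id Function.injective_id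
  set i₀ := ι ⟨D, hDmem, hxD⟩ with hi₀
  set t : Xs.presheaf.stalk x := u i₀ with htdef
  have ht : stalkIdeal D x = Ideal.span {t} := hι ⟨D, hDmem, hxD⟩
  have htm : t ∈ maximalIdeal (Xs.presheaf.stalk x) := hu ▸ Ideal.subset_span ⟨i₀, rfl⟩
  have ht2 : t ∉ maximalIdeal (Xs.presheaf.stalk x) ^ 2 := hrsop.not_mem_sq i₀
  have htE : stalkIdeal (vanishingIdeal D.support) x = Ideal.span {t} := by
    rw [hsnc.vanishingIdeal_support hDmem, ht]
  refine hnpc (hasNormalSylow_inertia_of_standardForm ρs p x fun a τ hkey hτ =>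
    ⟨1, fun _ => t, fun _ => htm, fun _ => ht2, fun g _ => ?_, fun g hg1 hg => ⟨0, ?_⟩⟩)
  · exact apply_mem_span_of_stalkIdeal_eq_span ρs x a τ hkey hτ D.support
      (fun g => hDstab (g : G)) htE g
  · have hg1' : (g : G) ≠ 1 := fun h => hg1 (Subtype.ext h)
    obtain ⟨K', hK', hK'g⟩ := htame (g : G) g.2 hg1' (by rwa [Subgroup.orderOf_coe])
    have htD : t ∈ stalkIdeal (𝒥.comap π) x := by
      rw [← hDdef, ht]
      exact Ideal.mem_span_singleton_self t
    exact Ideal.mem_sup_left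
      (mem_augIdeal_of_mem_stalkIdeal_comap ρs ρ π hequiv p x a τ hkey hτ g hg g.2 Wc le_rfl
        (hZW (g : G) K' hK' hK'g) (hZ' _) htD)

end Summit.ResolutionOfSingularities.ResolutionOfSingularities.Theorems.WildQuotientResolution.StandardForm

end
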